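import Summits.AtomisticToContinuum.HydrodynamicLimit.Cruxes.MeanEulerLimit.Vetting
import Summits.AtomisticToContinuum.HydrodynamicLimit.Cruxes.MeanEulerLimit.Lines.birth
import Summits.AtomisticToContinuum.HydrodynamicLimit.Cruxes.RestartPrinciple.StrategyCensus
import HarnessLib

/-!
# STRATEGY CENSUS certificate — crux `MeanEulerLimit` (stmt-AtomisticToContinuum-17727)

Crux-strategist REDIRECT r1 evidence file (route `route-AtomisticToContinuum-TwoTimePressureGerm`,
2026-08-17). Nothing here is proposed to the tree: every non-trivial proof term is a NAME that already
elaborates under `Theorems/` or in a committed crux workfile (`Cruxes/MeanEulerLimit/Vetting.lean`,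
refuter certificate, commit 4640921cf476; `Cruxes/MeanEulerLimit/Lines/birth.lean`, the registered BC3
skeleton; `Cruxes/RestartPrinciple/StrategyCensus.lean`). It kernel-checks the headings of
`STRATEGY-CENSUS.md`:

* §0 THE NODE: `MeanEulerLimit ↔ _root_.HydrodynamicLimit` (S → C by the in-tree uniform-integrability
  theorem `RestartPrinciple.tendsto_means_flow_of_tendstoHydroFieldsAt_of_solution`; C → S through the
  LANDED mean closure `RestartPrinciple.hydrodynamicLimit_of_meanHydroLimitInBand`, MeanClosure 11929
  proved p128739). Consequences: `TiltSubGaussian` is idle in `closes`, the route's `Assembly`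
  (stmt-17774) is a one-liner, and 17727 ≡ 11927 (`ResponseRigidity.MeanHydroLimitInBand`).
* §1 LEVERAGE RIGIDITY (line-independent): any `L` with `conjunct → L → crux` is the conjunct; any split
  whose other pieces are proved leaves its open piece `⇒ conjunct`; every bridge `T → crux` is a
  consequence of the conjunct and, given `T`, equivalent to it.
* §2 DECOMPOSITIONS, typed: D1 = the registered birth skeleton (its heart S2 dominates the conjunct given
  the two plumbing stubs); D2 = split by conserved field (assembly proved; the triple is jointly `↔`
  the conjunct and each piece is a consequence of it); D3 = near-equilibrium engine + zoom (the zoom is a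
  bridge: consequence of the conjunct, and `↔` conjunct given `NearEqGerm`, in particular given the
  route's engine cruxes `CumulantBounds`, `EquilibriumResponse` through `EngineNearEq`).
* §3 STRENGTHENINGS by name: exponential currency (`EulerPressureGerm`, above the crux through the
  provable-now support `GermToLimit`), one-body local equilibrium in the mean (= D1's heart), restartable
  currency (`RHL ↔ conjunct`, RestartPrinciple census).
-/

noncomputable section

namespace Summit.AtomisticToContinuum.HydrodynamicLimit.Cruxes.MeanEulerLimit.StrategyCensus

open MeasureTheory Filter Set Topology
open Literature.MathematicalPhysics.KineticTheory Literature.Analysis.FluidPDE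
open Summit.AtomisticToContinuum.HydrodynamicLimit.Theses
open Summit.AtomisticToContinuum.HydrodynamicLimit.Theses.TwoTimePressureGerm
  (MeanEulerLimit TiltSubGaussian EulerPressureGerm NearEqGerm GermToLimit Assembly CumulantBounds
    EquilibriumResponse EngineNearEq)
open Summit.AtomisticToContinuum.HydrodynamicLimit.Cruxes.MeanEulerLimit

/-! ## §0 The node: the crux is the conjunct (refuter certificate, by name) -/

/-- **17727 ≡ the sub-problem conjunct.** -/
theorem crux_iff_conjunct : MeanEulerLimit ↔ _root_.HydrodynamicLimit :=
  Vetting.meanEulerLimit_iff_hydrodynamicLimit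

theorem conjunct_of_crux : MeanEulerLimit → _root_.HydrodynamicLimit := crux_iff_conjunct.1

theorem crux_of_conjunct : _root_.HydrodynamicLimit → MeanEulerLimit := crux_iff_conjunct.2

/-- **Dedup: 17727 ≡ 11927** (`ResponseRigidity.MeanHydroLimitInBand`, the rank-0 target of
ResponseRigidity and AthermalClockWard). -/
theorem crux_iff_meanHydroLimitInBand : MeanEulerLimit ↔ ResponseRigidity.MeanHydroLimitInBand :=
  ⟨Vetting.meanHydroLimitInBand_of_meanEulerLimit, fun h =>
    crux_of_conjunct (Theorems.RestartPrinciple.hydrodynamicLimit_of_meanHydroLimitInBand h)⟩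

/-- The route's deciding theorem `closes (hM : MeanEulerLimit) (hS : TiltSubGaussian)` has an idle
binder: `MeanEulerLimit` alone closes. -/
theorem tiltSubGaussian_idle : MeanEulerLimit → _root_.HydrodynamicLimit := conjunct_of_crux

/-- The route's `Assembly` item (stmt-AtomisticToContinuum-17774, "provable-now, M: ≈300–500 lines")
is a one-liner given §0. -/
theorem assembly_now : Assembly := fun hM _ => conjunct_of_crux hM

/-! ## §1 Leverage rigidity (line-independent) -/

/-- Any statement sandwiched between the conjunct and the crux IS the conjunct (and the crux). -/
theorem leverage_rigidity (L : Prop) (hSL : _root_.HydrodynamicLimit → L) (hLX : L → MeanEulerLimit) :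
    (L ↔ _root_.HydrodynamicLimit) ∧ (L ↔ MeanEulerLimit) :=
  ⟨⟨fun h => conjunct_of_crux (hLX h), hSL⟩, ⟨hLX, fun h => hSL (conjunct_of_crux h)⟩⟩

/-- A split `R → L → crux` whose other piece(s) `R` are proved leaves the open piece `L ⇒ conjunct`:
if `L` is moreover a consequence of the conjunct (every "physically true" piece weaker than the summit
is), `L` is the conjunct by `leverage_rigidity`. -/
theorem residue_dominates (R L : Prop) (hR : R) (hsplit : R → L → MeanEulerLimit) :
    L → _root_.HydrodynamicLimit := fun hL => conjunct_of_crux (hsplit hR hL)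

/-- Bridge splits `T ∧ (T → crux)`: the bridge is ALWAYS a consequence of the conjunct … -/
theorem bridge_of_conjunct (T : Prop) : _root_.HydrodynamicLimit → (T → MeanEulerLimit) :=
  fun h _ => crux_of_conjunct h

/-- … and, as soon as `T` holds, it is equivalent to the conjunct. -/
theorem bridge_rigidity (T : Prop) (hT : T) : (T → MeanEulerLimit) ↔ _root_.HydrodynamicLimit :=
  ⟨fun b => conjunct_of_crux (b hT), fun h => bridge_of_conjunct T h⟩

/-! ## §2 Decomposition attempts, typed

### D1 — the registered birth skeleton (`Lines/birth.lean`): one-body local equilibrium in the mean -/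

/-- D1 assembly (registered, sorry-free in `Lines/birth.lean`): statics S1 → propagation S2 →
Maxwellian read-out S3 → crux. -/
theorem D1_assembly : Birth.Sig.stub_staticLocalEquilibrium → Birth.Sig.stub_localEquilibriumPropagation →
    Birth.Sig.stub_maxwellianMomentReadout → MeanEulerLimit :=
  Birth.MeanEulerLimit_of

/-- **D1's open piece dominates the conjunct.** Given the two plumbing stubs (S1 Gaussian statics, S3
Gaussian read-out; both "provable now", VET.md 2026-08-17), the heart S2 (propagation of one-body local
equilibrium in the mean) alone gives the CONJUNCT — a single open piece `⇒ summit`: rule-N, no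
redirect. -/
theorem D1_heart_dominates (h1 : Birth.Sig.stub_staticLocalEquilibrium)
    (h3 : Birth.Sig.stub_maxwellianMomentReadout) :
    Birth.Sig.stub_localEquilibriumPropagation → _root_.HydrodynamicLimit :=
  fun h2 => conjunct_of_crux (Birth.MeanEulerLimit_of h1 h2 h3)

/-! ### D2 — split by conserved field (density / momentum / energy), each in the crux's exact frame -/

/-- D2 piece 1: the MEAN DENSITY field closes on `ρ_t` (crux frame, density clause only). -/
def MeanDensityLimit : Prop :=
  open Literature.MathematicalPhysics.KineticTheory Literature.Analysis.FluidPDE MeasureTheory Filter Topology in ∃ η₀ : ℝ, 0 < η₀ ∧ ∀ (a₀ θ₀ : T3 → ℝ) (u₀ : T3 → V3), Continuous a₀ → Continuous θ₀ → Continuous u₀ → (∀ x, 0 < a₀ x) → (∀ x, 0 < θ₀ x) → ∃ σ₀ : ℝ, 0 < σ₀ ∧ ∀ σ : ℝ, 0 < σ → σ < σ₀ → ∀ (T : ℝ) (ρ θ : ℝ → T3 → ℝ) (u : ℝ → T3 → V3), IsHardSphereEulerSolution σ T ρ u θ → (∀ t ∈ Set.Ico 0 T, ∀ x, ρ t x *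 σ ^ 3 < η₀) → ∀ Φ : (N : ℕ) → HardSphereFlow (Torus.geometry (Fin 3)) (hsDiameter σ N) (N + 1), TendstoHydroFieldsAt (fun N => localGibbsLaw σ a₀ u₀ θ₀ N (Φ N)) Φ ρ u θ 0 → ∀ t ∈ Set.Ico 0 T, ∀ χ : T3 → ℝ, Continuous χ → Tendsto (fun N : ℕ => ∫ z, empiricalDensityField ((Φ N).flow t z) χ ∂(localGibbsLaw σ a₀ u₀ θ₀ N (Φ N))) atTop (𝓝 (∫ x, χ x * ρ t x))

/-- D2 piece 2: the MEAN MOMENTUM field closes on `ρ_t u_t` (crux frame, momentum clause only; in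
substance the closure of the mean stress on `ρ u ⊗ u + ρθZ(ρσ³)𝟙`). -/
def MeanMomentumLimit : Prop :=
  open Literature.MathematicalPhysics.KineticTheory Literature.Analysis.FluidPDE MeasureTheory Filter Topology in ∃ η₀ : ℝ, 0 < η₀ ∧ ∀ (a₀ θ₀ : T3 → ℝ) (u₀ : T3 → V3), Continuous a₀ → Continuous θ₀ → Continuous u₀ → (∀ x, 0 < a₀ x) → (∀ x, 0 < θ₀ x) → ∃ σ₀ : ℝ, 0 < σ₀ ∧ ∀ σ : ℝ, 0 < σ → σ < σ₀ → ∀ (T : ℝ) (ρ θ : ℝ → T3 → ℝ) (u : ℝ → T3 → V3), IsHardSphereEulerSolution σ T ρ u θ → (∀ t ∈ Set.Ico 0 T, ∀ x, ρ t x * σ ^ 3 < η₀) → ∀ Φ : (N : ℕ) → HardSphereFlow (Torus.geometry (Fin 3)) (hsDiameter σ N) (N + 1), TendstoHydroFieldsAt (fun N => localGibbsLaw σ a₀ u₀ θ₀ N (Φ N)) Φ ρ u θ 0 → ∀ t ∈ Set.Ico 0 T, ∀ χ : T3 → ℝ, Continuous χ → Tendsto (fun N : ℕ => ∫ z, empiricalMomentumField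 ((Φ N).flow t z) χ ∂(localGibbsLaw σ a₀ u₀ θ₀ N (Φ N))) atTop (𝓝 (∫ x, (χ x * ρ t x) • u t x))

/-- D2 piece 3: the MEAN ENERGY field closes on `E_t` (crux frame, energy clause only; in substance the
closure of the mean energy current on `(E + p)u`). -/
def MeanEnergyLimit : Prop :=
  open Literature.MathematicalPhysics.KineticTheory Literature.Analysis.FluidPDE MeasureTheory Filter Topology in ∃ η₀ : ℝ, 0 < η₀ ∧ ∀ (a₀ θ₀ : T3 → ℝ) (u₀ : T3 → V3), Continuous a₀ → Continuous θ₀ → Continuous u₀ → (∀ x, 0 < a₀ x) → (∀ x, 0 < θ₀ x) → ∃ σ₀ : ℝ, 0 < σ₀ ∧ ∀ σ : ℝ, 0 < σ → σ < σ₀ → ∀ (T : ℝ) (ρ θ : ℝ → T3 → ℝ) (u : ℝ → T3 → V3), IsHardSphereEulerSolution σ T ρ u θ → (∀ t ∈ Set.Ico 0 T, ∀ x, ρ t x * σ ^ 3 < η₀) → ∀ Φ : (N : ℕ) → HardSphereFlow (Torus.geometry (Fin 3)) (hsDiameter σ N) (N + 1), TendstoHydroFieldsAt (fun N => localGibbsLaw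 σ a₀ u₀ θ₀ N (Φ N)) Φ ρ u θ 0 → ∀ t ∈ Set.Ico 0 T, ∀ χ : T3 → ℝ, Continuous χ → Tendsto (fun N : ℕ => ∫ z, empiricalEnergyField ((Φ N).flow t z) χ ∂(localGibbsLaw σ a₀ u₀ θ₀ N (Φ N))) atTop (𝓝 (∫ x, χ x * totalEnergyDensity (ρ t x) (u t x) (θ t x)))

/-- **D2 assembly (proved): the three field closures give the crux** (`η₀ := min`, `σ₀ := min`, a
smaller threshold only strengthens the guard hypothesis). -/
theorem D2_assembly : MeanDensityLimit → MeanMomentumLimit → MeanEnergyLimit → MeanEulerLimit := by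
  rintro ⟨η₁, hη₁, H₁⟩ ⟨η₂, hη₂, H₂⟩ ⟨η₃, hη₃, H₃⟩
  refine ⟨min η₁ (min η₂ η₃), lt_min hη₁ (lt_min hη₂ hη₃), fun a₀ θ₀ u₀ ha hθ hu ha0 hθ0 => ?_⟩
  obtain ⟨σ₁, hσ₁, G₁⟩ := H₁ a₀ θ₀ u₀ ha hθ hu ha0 hθ0
  obtain ⟨σ₂, hσ₂, G₂⟩ := H₂ a₀ θ₀ u₀ ha hθ hu ha0 hθ0
  obtain ⟨σ₃, hσ₃, G₃⟩ := H₃ a₀ θ₀ u₀ ha hθ hu ha0 hθ0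
  refine ⟨min σ₁ (min σ₂ σ₃), lt_min hσ₁ (lt_min hσ₂ hσ₃), ?_⟩
  intro σ hσ hσ' T ρ θ u hsol hη Φ h0 t ht χ hχ
  have e₁ : min η₁ (min η₂ η₃) ≤ η₁ := min_le_left _ _
  have e₂ : min η₁ (min η₂ η₃) ≤ η₂ := (min_le_right _ _).trans (min_le_left _ _)
  have e₃ : min η₁ (min η₂ η₃) ≤ η₃ := (min_le_right _ _).trans (min_le_right _ _)
  have s₁ : σ < σ₁ := hσ'.trans_le (min_le_left _ _)
  have s₂ : σ < σ₂ := hσ'.trans_le ((min_le_right _ _).trans (min_le_left _ _))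
  have s₃ : σ < σ₃ := hσ'.trans_le ((min_le_right _ _).trans (min_le_right _ _))
  exact ⟨G₁ σ hσ s₁ T ρ θ u hsol (fun s hs x => (hη s hs x).trans_le e₁) Φ h0 t ht χ hχ,
    G₂ σ hσ s₂ T ρ θ u hsol (fun s hs x => (hη s hs x).trans_le e₂) Φ h0 t ht χ hχ,
    G₃ σ hσ s₃ T ρ θ u hsol (fun s hs x => (hη s hs x).trans_le e₃) Φ h0 t ht χ hχ⟩

/-- **Each D2 piece is a consequence of the conjunct** (projection of the crux). -/
theorem D2_pieces_of_conjunct (h : _root_.HydrodynamicLimit) :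
    MeanDensityLimit ∧ MeanMomentumLimit ∧ MeanEnergyLimit := by
  obtain ⟨η₀, hη₀, H⟩ := crux_of_conjunct h
  refine ⟨⟨η₀, hη₀, fun a₀ θ₀ u₀ ha hθ hu ha0 hθ0 => ?_⟩, ⟨η₀, hη₀, fun a₀ θ₀ u₀ ha hθ hu ha0 hθ0 => ?_⟩,
    ⟨η₀, hη₀, fun a₀ θ₀ u₀ ha hθ hu ha0 hθ0 => ?_⟩⟩
  · obtain ⟨σ₀, hσ₀, H1⟩ := H a₀ θ₀ u₀ ha hθ hu ha0 hθ0
    exact ⟨σ₀, hσ₀, fun σ hσ hσ' T ρ θ u hsol hη Φ h0 t ht χ hχ =>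
      (H1 σ hσ hσ' T ρ θ u hsol hη Φ h0 t ht χ hχ).1⟩
  · obtain ⟨σ₀, hσ₀, H1⟩ := H a₀ θ₀ u₀ ha hθ hu ha0 hθ0
    exact ⟨σ₀, hσ₀, fun σ hσ hσ' T ρ θ u hsol hη Φ h0 t ht χ hχ =>
      (H1 σ hσ hσ' T ρ θ u hsol hη Φ h0 t ht χ hχ).2.1⟩
  · obtain ⟨σ₀, hσ₀, H1⟩ := H a₀ θ₀ u₀ ha hθ hu ha0 hθ0
    exact ⟨σ₀, hσ₀, fun σ hσ hσ' T ρ θ u hsol hη Φ h0 t ht χ hχ =>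
      (H1 σ hσ hσ' T ρ θ u hsol hη Φ h0 t ht χ hχ).2.2⟩

/-- **D2 joint rigidity: the triple IS the conjunct** (an unassigned conjunct split is summit-strength;
no single piece has a lever that is not a lever for all three — local equilibrium in any currency
delivers the five fields at once, `D1_heart_dominates`). -/
theorem D2_joint_iff : (MeanDensityLimit ∧ MeanMomentumLimit ∧ MeanEnergyLimit) ↔ _root_.HydrodynamicLimit :=
  ⟨fun h => conjunct_of_crux (D2_assembly h.1 h.2.1 h.2.2), D2_pieces_of_conjunct⟩

/-! ### D3 — the route's own plan: near-equilibrium engine (`EngineNearEq ⇒ NearEqGerm`) + the ZOOM -/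

/-- The untyped "zoom" of the route header, in its only honest typed form at this node: a bridge from the
near-equilibrium Euler germ (small exact-tilt data) to the crux (all data). -/
def Zoom : Prop := NearEqGerm → MeanEulerLimit

/-- D3 assembly (modus ponens). -/
theorem D3_assembly : NearEqGerm → Zoom → MeanEulerLimit := fun h z => z h

/-- The zoom is a consequence of the conjunct … -/
theorem D3_zoom_of_conjunct : _root_.HydrodynamicLimit → Zoom := bridge_of_conjunct NearEqGerm

/-- … and, once the near-equilibrium germ is in hand, it IS the conjunct. -/
theorem D3_zoom_rigidity (hT : NearEqGerm) : Zoom ↔ _root_.HydrodynamicLimit :=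
  bridge_rigidity NearEqGerm hT

/-- In particular, relative to the route's two engine cruxes (`CumulantBounds` 9615, `EquilibriumResponse`
14332) and its provable engine glue `EngineNearEq` (14336): the remaining piece of the route's plan for
this crux is the conjunct. -/
theorem D3_zoom_rigidity_engine (hC : CumulantBounds) (hR : EquilibriumResponse) (hE : EngineNearEq) :
    Zoom ↔ _root_.HydrodynamicLimit :=
  bridge_rigidity NearEqGerm (hE hC hR)

/-! ## §3 Strengthenings, by name -/

/-- St1 — exponential currency. The route's target `EulerPressureGerm` (17752) sits ABOVE the crux through
the provable-now support `GermToLimit` (14338): its slope half is the crux itself. -/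
theorem St1_exponential_currency (hGL : GermToLimit) : EulerPressureGerm → MeanEulerLimit :=
  fun h => crux_of_conjunct (hGL h)

/-- St2 — one-body local equilibrium in the mean at all `t < T` (the birth line's intermediate property,
Spohn's (3.22) in expectation): given the two plumbing stubs it dominates the conjunct (= D1). -/
theorem St2_oneBody_localEquilibrium (h1 : Birth.Sig.stub_staticLocalEquilibrium)
    (h3 : Birth.Sig.stub_maxwellianMomentReadout) :
    Birth.Sig.stub_localEquilibriumPropagation → MeanEulerLimit :=
  fun h2 => Birth.MeanEulerLimit_of h1 h2 h3

/-- St3 — restartable currency (restart from any `s₀ ∈ [0,T)` with a uniform prefix): `RHL ↔ conjunct`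
(RestartPrinciple census, p108006 / p103746), hence `RHL ↔ crux`. -/
theorem St3_restartable_currency :
    Cruxes.RestartPrinciple.StrategyCensus.RHL ↔ MeanEulerLimit :=
  Cruxes.RestartPrinciple.StrategyCensus.rhl_iff_conjunct.trans crux_iff_conjunct.symm

end Summit.AtomisticToContinuum.HydrodynamicLimit.Cruxes.MeanEulerLimit.StrategyCensus

end
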